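import Literature.AlgebraicGeometry.Motives.ZarhinHodgeGroupOrthogonalLie
import Mathlib.LinearAlgebra.Dual.Lemmas
import HarnessLib

/-!
# Zarhin's Lie-algebra lemma, unitary case: an irreducible skew Lie algebra containing the Hodge element contains the `gl(W)` block of an isotropic pair (Zarhin's theorem, step 6, CM case)

Pure linear algebra over a field `K` of characteristic `0`, companion of
`ZarhinHodgeGroupOrthogonalLie.lean` (whose wedge elements
`x ∧ y = smulRight (B y) x - smulRight (B x) y ∈ so(V, B)` and graded-component lemmas are
reused). Let `B` be a symmetric bilinear form on a finite-dimensional `V`, `S ⊆ End(V)` a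
subspace closed under commutators and consisting of `B`-skew endomorphisms, preserving two
ISOTROPIC subspaces `W`, `W'`; let `e ∈ W`, `f ∈ W'` with `B(e,f) = 1`, `e ∧ f ∈ S`, such that the
pairing `B : (W ∩ f^⊥) × (W' ∩ e^⊥) → K` has trivial kernel on the `W'` side and `W` is
`S`-irreducible. THEN `x ∧ y ∈ S` for all `x ∈ W`, `y ∈ W'`
(`wedge_mem_of_irreducible_of_isotropic`).

In Zarhin's theorem on the Hodge group of a Hodge structure of K3 type with CM endomorphism
field (Yu. G. Zarhin, *Hodge groups of K3 surfaces*, 1983, Thm. 2.3.1: `Hdg = U_E(T, Ψ)`;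
D. Huybrechts, *Lectures on K3 Surfaces*, Thm. 3.3.9, CM case) this is applied to `V = T_ℂ`,
`S = Lie(Hdg)_ℂ`, `W = T_σ`, `W' = T_σ̄` (eigenspaces of `E = End_Hdg(T)` for a complex embedding
and its conjugate, isotropic and perfectly paired by the polarization), `e ∈ T^{2,0} ⊆ T_σ`,
`f ∈ T^{0,2} ⊆ T_σ̄`, `2 e∧f = Θ`. Zarhin's printed proof is representation-theoretic; the
tree's DEVIATION is the elementary argument: with `A₊ = {y ∈ W' ∩ e^⊥ | e∧y ∈ S}` and
`A₋ = {x ∈ W ∩ f^⊥ | f∧x ∈ S}`, every `X ∈ S` decomposes into graded pieces lying in `S`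
(lemmas of the orthogonal file), the subspace `Ke + A₋` is always `S`-stable (so `A₋ = W ∩ f^⊥`
by irreducibility), `{x ∈ W ∩ f^⊥ | x ⊥ A₊}` is `S`-stable and misses `e` (so it vanishes), whence
`A₊ = W' ∩ e^⊥` by a dimension count, and the brackets `[e∧y, x∧f]` produce the mixed wedges.
No definitions, no named facts.

## References

* Yu. G. Zarhin, *Hodge groups of K3 surfaces*, J. reine angew. Math. 341 (1983) 193–220,
  Thm. 2.3.1.
* D. Huybrechts, *Lectures on K3 Surfaces* (CUP 2016), Ch. 3, Thm. 3.3.9, Rem. 3.3.10.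
-/

noncomputable section

namespace Literature.AlgebraicGeometry.Motives

namespace ZarhinLie

universe u v

variable {K : Type u} [Field K] {V : Type v} [AddCommGroup V] [Module K V]
  (B : LinearMap.BilinForm K V)

/-! ### The unitary (CM) case -/

section Unitary

variable {B} [CharZero K] (hB : ∀ x y, B x y = B y x)
  {S : Submodule K (Module.End K V)}
  (hS_lie : ∀ X ∈ S, ∀ Y ∈ S, X * Y - Y * X ∈ S)
  (hS_skew : ∀ X ∈ S, ∀ w w', B (X w) w' = -B w (X w'))
  {e f : V} (hef : B e f = 1)
  (hE : (LinearMap.smulRight (B f) e - LinearMap.smulRight (B e) f : Module.End K V) ∈ S)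

include hB hS_lie hS_skew hef hE in
/-- **Zarhin's Lie-algebra lemma, unitary (CM) case.** Let `S ⊆ End(V)` be a subspace closed
under commutators and consisting of `B`-skew endomorphisms (`B` symmetric, characteristic `0`,
`V` finite-dimensional), preserving two ISOTROPIC subspaces `W`, `W'`; let `e ∈ W`, `f ∈ W'` with
`B(e,f) = 1` and `e ∧ f ∈ S`; assume the pairing of `W₀ = W ∩ f^⊥` with `W'₀ = W' ∩ e^⊥` has
trivial kernel on the `W'₀` side, and that `W` is `S`-irreducible. Then `x ∧ y ∈ S` for all
`x ∈ W`, `y ∈ W'`, i.e. `S` contains the full "`gl(W)`" block `Hom`-paired with `W'`. In Zarhin's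
theorem (Huybrechts Thm. 3.3.9, CM case; Zarhin 1983, Thm. 2.3.1) this is applied to
`W = T_σ`, `W' = T_σ̄`, `2 e∧f = Θ`. Proof (elementary replacement of Zarhin's argument): with
`A₊ = {y ∈ W'₀ | e∧y ∈ S}`, `A₋ = {x ∈ W₀ | f∧x ∈ S}`, the subspace `Ke + A₋` is always
`S`-stable, so `A₋ = W₀`; `{x ∈ W₀ | x ⊥ A₊}` is `S`-stable and misses `e`, so it is `0`, whence
`A₊ = W'₀` by counting dimensions; brackets give the mixed wedges.
[cite: Zarhin1983HodgeGroupsK3, Thm. 2.3.1] -/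
theorem wedge_mem_of_irreducible_of_isotropic [FiniteDimensional K V] {W W' : Submodule K V}
    (hSW : ∀ X ∈ S, ∀ w ∈ W, X w ∈ W) (hSW' : ∀ X ∈ S, ∀ w ∈ W', X w ∈ W')
    (hWiso : ∀ x ∈ W, ∀ y ∈ W, B x y = 0) (hW'iso : ∀ x ∈ W', ∀ y ∈ W', B x y = 0)
    (he : e ∈ W) (hf : f ∈ W')
    (hperf : ∀ y ∈ W', B e y = 0 → (∀ x ∈ W, B f x = 0 → B y x = 0) → y = 0)
    (hirr : ∀ U : Submodule K V, U ≤ W → (∀ X ∈ S, ∀ u ∈ U, X u ∈ U) → U = ⊥ ∨ U = W)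
    {x y : V} (hx : x ∈ W) (hy : y ∈ W') : (LinearMap.smulRight (B y) x - LinearMap.smulRight (B x) y : Module.End K V) ∈ S := by
  have hee : B e e = 0 := hWiso e he e he
  have hff : B f f = 0 := hW'iso f hf f hf
  have hfe : B f e = 1 := (hB f e).trans hef
  have he0 : e ≠ 0 := fun h => by
    rw [h, map_zero] at hfe
    exact zero_ne_one hfe
  -- `A₊ = {y ∈ W'₀ | e∧y ∈ S}`, `A₋ = {x ∈ W₀ | f∧x ∈ S}`
  let Ap : Submodule K V :=
    { carrier := {u | u ∈ W' ∧ B e u = 0 ∧ (LinearMap.smulRight (B u) e - LinearMap.smulRight (B e) u : Module.End K V) ∈ S}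
      add_mem' := fun {a b} ha hb => ⟨W'.add_mem ha.1 hb.1,
        by rw [map_add, ha.2.1, hb.2.1, add_zero],
        by rw [wedge_add_right]; exact S.add_mem ha.2.2 hb.2.2⟩
      zero_mem' := ⟨W'.zero_mem, by rw [map_zero], by rw [wedge_zero_right]; exact S.zero_mem⟩
      smul_mem' := fun c a ha => ⟨W'.smul_mem c ha.1, by rw [map_smul, ha.2.1, smul_zero],
        by rw [wedge_smul_right]; exact S.smul_mem c ha.2.2⟩ }
  let Am : Submodule K V :=
    { carrier := {v | v ∈ W ∧ B f v = 0 ∧ (LinearMap.smulRight (B v) f - LinearMap.smulRight (B f) v : Module.End K V) ∈ S}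
      add_mem' := fun {a b} ha hb => ⟨W.add_mem ha.1 hb.1,
        by rw [map_add, ha.2.1, hb.2.1, add_zero],
        by rw [wedge_add_right]; exact S.add_mem ha.2.2 hb.2.2⟩
      zero_mem' := ⟨W.zero_mem, by rw [map_zero], by rw [wedge_zero_right]; exact S.zero_mem⟩
      smul_mem' := fun c a ha => ⟨W.smul_mem c ha.1, by rw [map_smul, ha.2.1, smul_zero],
        by rw [wedge_smul_right]; exact S.smul_mem c ha.2.2⟩ }
  -- (1) components: `ȳ_X = B(Xf,e) f - Xf ∈ A₊`, `x_X = Xe - B(Xe,f) e ∈ A₋`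
  have hcomp : ∀ X ∈ S, B (X f) e • f - X f ∈ Ap ∧ X e - B (X e) f • e ∈ Am := fun X hX => by
    obtain ⟨hP, hQ⟩ := wedge_uPart_mem_and_wedge_vPart_mem hB hS_lie hS_skew hee hff hef hE hX
    refine ⟨⟨W'.sub_mem (W'.smul_mem _ hf) (hSW' X hX f hf), ?_, hP⟩,
      ⟨W.sub_mem (hSW X hX e he) (W.smul_mem _ he), ?_, ?_⟩⟩
    · rw [map_sub, map_smul, smul_eq_mul, hef, mul_one, hB e (X f), sub_self]
    · rw [map_sub, map_smul, smul_eq_mul, hfe, mul_one, hB f (X e), sub_self]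
    · have : (LinearMap.smulRight (B (X e - B (X e) f • e)) f - LinearMap.smulRight (B f) (X e - B (X e) f • e) : Module.End K V) = -(LinearMap.smulRight (B (B (X e) f • e - X e)) f - LinearMap.smulRight (B f) (B (X e) f • e - X e) : Module.End K V) := by
        rw [wedge_sub_right, wedge_sub_right]
        exact (neg_sub _ _).symm
      rw [this]
      exact S.neg_mem hQ
  -- (2) the degree-`0` elements of `S` preserve `A₊` and `A₋`
  have hZact : ∀ Z ∈ S, Z e = 0 → Z f = 0 → (∀ u ∈ Ap, Z u ∈ Ap) ∧ (∀ v ∈ Am, Z v ∈ Am) := by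
    intro Z hZ hZe hZf
    refine ⟨fun u hu => ?_, fun v hv => ?_⟩
    · obtain ⟨hmem, horth⟩ := wedge_e_apply_mem hB hS_lie hS_skew hZ hZe hu.2.2
      exact ⟨hSW' Z hZ u hu.1, horth, hmem⟩
    · obtain ⟨hmem, horth⟩ := wedge_e_apply_mem hB hS_lie hS_skew hZ hZf hv.2.2
      exact ⟨hSW Z hZ v hv.1, horth, hmem⟩
  -- (3) `x ∧ y ∈ S` kills `e`, `f` for `y ∈ A₊`, `x ∈ A₋`
  have huv : ∀ v ∈ Am, ∀ u ∈ Ap, (LinearMap.smulRight (B u) v - LinearMap.smulRight (B v) u : Module.End K V) ∈ S ∧ (LinearMap.smulRight (B u) v - LinearMap.smulRight (B v) u : Module.End K V) e = 0 ∧ (LinearMap.smulRight (B u) v - LinearMap.smulRight (B v) u : Module.End K V) f = 0 := by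
    intro v hv u hu
    have h := wedge_mem_of_wedge_e_mem_of_wedge_f_mem hB hS_lie hef hE (hW'iso f hf u hu.1)
      (hWiso e he v hv.1) hu.2.2 hv.2.2
    refine ⟨by rw [wedge_swap]; exact S.neg_mem h, ?_, ?_⟩
    · rw [wedge_apply, hB u e, hu.2.1, hWiso v hv.1 e he, zero_smul, zero_smul, sub_zero]
    · rw [wedge_apply, hW'iso u hu.1 f hf, hB v f, hv.2.1, zero_smul, zero_smul, sub_zero]
  -- how `X ∈ S` acts on `e` and on vectors of `W₀`
  have hXe : ∀ X : Module.End K V, X e = B (X e) f • e + (X e - B (X e) f • e) := fun X => by abel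
  have hXu : ∀ X ∈ S, ∀ u ∈ W, B f u = 0 →
      X u = B (B (X f) e • f - X f) u • e +
        (X - B (X e) f • (LinearMap.smulRight (B f) e - LinearMap.smulRight (B e) f : Module.End K V) - (LinearMap.smulRight (B (B (X f) e • f - X f)) e - LinearMap.smulRight (B e) (B (X f) e • f - X f) : Module.End K V) - (LinearMap.smulRight (B (B (X e) f • e - X e)) f - LinearMap.smulRight (B f) (B (X e) f • e - X e) : Module.End K V)) u := by
    intro X hX u hu huf
    have hue : B e u = 0 := hWiso e he u hu
    have hxu : B (X e) u = 0 := hWiso _ (hSW X hX e he) u hu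
    simp only [LinearMap.sub_apply, LinearMap.smul_apply, LinearMap.smulRight_apply, map_sub,
      map_smul, smul_eq_mul, hue, huf, hxu]
    module
  have hZ : ∀ X (hX : X ∈ S), _ := fun X hX => zPart_mem hB hS_lie hS_skew hee hff hef hE hX
  have hApW : Ap ≤ W' := fun u hu => hu.1
  have hAmW : Am ≤ W := fun v hv => hv.1
  -- (4) `A₋ = W₀` via the `S`-stable subspace `Ke + A₋`
  have hW₀ : ∀ w ∈ W, B f w = 0 → w ∈ Am := by
    set U := (K ∙ e) ⊔ Am with hU
    have hUW : U ≤ W := sup_le ((Submodule.span_singleton_le_iff_mem e W).2 he) hAmW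
    have heU : e ∈ U := Submodule.mem_sup_left (Submodule.mem_span_singleton_self e)
    have hAmU : Am ≤ U := le_sup_right
    have hUstab : ∀ X ∈ S, ∀ w ∈ U, X w ∈ U := by
      intro X hX w hw
      obtain ⟨w₁, hw₁, v, hv, rfl⟩ := Submodule.mem_sup.1 hw
      obtain ⟨a, rfl⟩ := Submodule.mem_span_singleton.1 hw₁
      rw [map_add, map_smul]
      refine U.add_mem (U.smul_mem _ ?_) ?_
      · rw [hXe X]
        exact U.add_mem (U.smul_mem _ heU) (hAmU (hcomp X hX).2)
      · rw [hXu X hX v hv.1 hv.2.1]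
        exact U.add_mem (U.smul_mem _ heU)
          (hAmU (((hZact _ (hZ X hX).1 (hZ X hX).2.1 (hZ X hX).2.2)).2 v hv))
    rcases hirr U hUW hUstab with h | h
    · exact absurd (h ▸ heU : e ∈ (⊥ : Submodule K V)) (by simpa using he0)
    intro w hw hwf
    rw [← h] at hw
    obtain ⟨w₁, hw₁, v, hv, rfl⟩ := Submodule.mem_sup.1 hw
    obtain ⟨a, rfl⟩ := Submodule.mem_span_singleton.1 hw₁
    have ha : a = 0 := by
      rw [map_add, map_smul, smul_eq_mul, hfe, hv.2.1, mul_one, add_zero] at hwf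
      exact hwf
    rw [ha, zero_smul, zero_add]
    exact hv
  -- (5) `{x ∈ W₀ | x ⊥ A₊} = 0` via irreducibility
  let U' : Submodule K V :=
    { carrier := {u | u ∈ W ∧ B f u = 0 ∧ ∀ z ∈ Ap, B z u = 0}
      add_mem' := fun {a b} ha hb => ⟨W.add_mem ha.1 hb.1,
        by rw [map_add, ha.2.1, hb.2.1, add_zero],
        fun z hz => by rw [map_add, ha.2.2 z hz, hb.2.2 z hz, add_zero]⟩
      zero_mem' := ⟨W.zero_mem, by rw [map_zero], fun z _ => by rw [map_zero]⟩
      smul_mem' := fun c a ha => ⟨W.smul_mem c ha.1, by rw [map_smul, ha.2.1, smul_zero],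
        fun z hz => by rw [map_smul, ha.2.2 z hz, smul_zero]⟩ }
  have hU' : U' = ⊥ := by
    have hU'W : U' ≤ W := fun u hu => hu.1
    have hstab : ∀ X ∈ S, ∀ u ∈ U', X u ∈ U' := by
      intro X hX u hu
      obtain ⟨hZmem, hZe, hZf⟩ := hZ X hX
      rw [hXu X hX u hu.1 hu.2.1, hu.2.2 _ (hcomp X hX).1, zero_smul, zero_add]
      refine ⟨hSW _ hZmem u hu.1, form_f_apply_eq_zero_of_apply_f hS_skew hZmem hZf u hB,
        fun z hz => ?_⟩
      rw [hB, hS_skew _ hZmem, neg_eq_zero, hB]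
      exact hu.2.2 _ ((hZact _ hZmem hZe hZf).1 z hz)
    rcases hirr U' hU'W hstab with h | h
    · exact h
    · exfalso
      have : e ∈ U' := h ▸ he
      have h1 := this.2.1
      rw [hfe] at h1
      exact one_ne_zero h1
  -- (6) `A₊ = W'₀` by counting dimensions
  have hAp_eq : ∀ z ∈ W', B e z = 0 → z ∈ Ap := by
    -- `W₀ ↪ Dual A₊` (kernel is `U' = 0`) and `W'₀ ↪ Dual W₀` (perfectness)
    let W₀ : Submodule K V := W ⊓ LinearMap.ker (B f)
    let W'₀ : Submodule K V := W' ⊓ LinearMap.ker (B e)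
    have hApW'₀ : Ap ≤ W'₀ := fun u hu => ⟨hu.1, hu.2.1⟩
    let r : W₀ →ₗ[K] Module.Dual K Ap := (LinearMap.domRestrict' Ap ∘ₗ B).domRestrict W₀
    have hr : Function.Injective r := by
      rw [← LinearMap.ker_eq_bot, LinearMap.ker_eq_bot']
      rintro ⟨u, hu⟩ hu0
      have : u ∈ U' := ⟨hu.1, hu.2, fun z hz => by
        have := LinearMap.congr_fun hu0 ⟨z, hz⟩
        rw [hB]
        simpa [r] using this⟩
      rw [hU', Submodule.mem_bot] at this
      exact Subtype.ext this
    let s' : W'₀ →ₗ[K] Module.Dual K W₀ := (LinearMap.domRestrict' W₀ ∘ₗ B).domRestrict W'₀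
    have hs' : Function.Injective s' := by
      rw [← LinearMap.ker_eq_bot, LinearMap.ker_eq_bot']
      rintro ⟨z, hz⟩ hz0
      have : z = 0 := hperf z hz.1 hz.2 fun u hu huf => by
        have := LinearMap.congr_fun hz0 ⟨u, ⟨hu, huf⟩⟩
        simpa [s'] using this
      exact Subtype.ext this
    have h1 : Module.finrank K W₀ ≤ Module.finrank K Ap := by
      have := LinearMap.finrank_le_finrank_of_injective hr
      rwa [Subspace.dual_finrank_eq] at this
    have h2 : Module.finrank K W'₀ ≤ Module.finrank K W₀ := by
      have := LinearMap.finrank_le_finrank_of_injective hs'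
      rwa [Subspace.dual_finrank_eq] at this
    have heq : Ap = W'₀ := Submodule.eq_of_le_of_finrank_le hApW'₀ (h2.trans h1)
    intro z hz hze
    rw [heq]
    exact ⟨hz, hze⟩
  -- (7) conclusion by bilinearity from `x = B(x,f) e + x₀`, `y = y₀ + B(y,e) f`
  have hx₀ : x - B x f • e ∈ Am := hW₀ _ (W.sub_mem hx (W.smul_mem _ he))
    (by rw [map_sub, map_smul, smul_eq_mul, hfe, mul_one, hB f x, sub_self])
  have hy₀ : y - B y e • f ∈ Ap := hAp_eq _ (W'.sub_mem hy (W'.smul_mem _ hf))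
    (by rw [map_sub, map_smul, smul_eq_mul, hef, mul_one, hB e y, sub_self])
  have hx' : x = B x f • e + (x - B x f • e) := by abel
  have hy' : y = (y - B y e • f) + B y e • f := by abel
  have hey : (LinearMap.smulRight (B y) e - LinearMap.smulRight (B e) y : Module.End K V) ∈ S := by
    rw [hy', wedge_add_right, wedge_smul_right]
    exact S.add_mem hy₀.2.2 (S.smul_mem _ hE)
  have hx₀y : (LinearMap.smulRight (B y) (x - B x f • e) - LinearMap.smulRight (B (x - B x f • e)) y : Module.End K V) ∈ S := by
    rw [hy', wedge_add_right, wedge_smul_right]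
    refine S.add_mem (huv _ hx₀ _ hy₀).1 (S.smul_mem _ ?_)
    rw [wedge_swap]
    exact S.neg_mem hx₀.2.2
  rw [hx', wedge_add_left, wedge_smul_left]
  exact S.add_mem (S.smul_mem _ hey) hx₀y

end Unitary

end ZarhinLie

end Literature.AlgebraicGeometry.Motives

end
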